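import Literature.MathematicalPhysics.QuantumFieldTheory.Balaban1983to89.B10Eq61CoefficientOnLie

/-!
# Balaban, CMP 102 (1985) [B10] p. 271 «we obtain the sum of terms −log det S(V_k^{(k)}, b₀(c))»: the SIGN of
`det S(V₀, b₀(c))|_𝔤` — POSITIVITY, derived

statement-level skeleton of published theorems with citation tags; proofs where landed; nothing here is a claim about
the Yang–Mills mass gap

PRINT ([B10] = Balaban1985UV3, p. 271, after (62)): «The elimination yields also a sum of local terms determined by the
coefficient at the variable A(b₀(c)) in (QA)(c). More exactly the coefficient is a linear operator S(V_k^{(k)}, b₀(c)) acting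
on the Lie algebra 𝔤, see the formula (124) [4] for a precise definition, and we obtain the sum of terms
−log det S(V_k^{(k)}, b₀(c)). They are simple, local, gauge invariant functions of V_k^{(k)} = Ū^k_{k+1}».  The group: [4] =
Balaban1985Averaging p. 18 «values in a Lie subgroup G of a unitary group U(N)», p. 20 «The group G is obtained by
applying the function e^{iA} to A ∈ 𝔤»; [B10] Theorem 1 p. 257 «semi-simple compact group Lie G».

WHAT THE TREE HAD.  `B10Eq61SpineCoefficient` §9–§9d (r07 v1.2–v1.5): the coefficient `S(V₀, b₀(c))` as a real-linear
endomorphism `fullCoeffOn` of an `S`-stable finite-dimensional `𝔤`, its main term `mainCoeffOn = L^{−d}·R(u)|_𝔤`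
(`u = V₀([c₋, b₀(c)₋])` the transporter along the spine), `|det S₀| = L^{−d·dim 𝔤}`, `det S ≠ 0` and `|det S| > 0` at a
regular background, gauge invariance of `|det S|`; `B10Eq61CoefficientOnLie` (r07): the stability `S𝔤 ⊆ 𝔤` derived
from the exponential chart.  The SIGN of `det S` was NOT asserted anywhere («the sign of det itself is not asserted»,
`abs_det_fullCoeffOn_pos`; HONEST SCOPE (iii) of `B10Eq61CoefficientOnLie`; the referee's DECLARED DIVERGENCE on the
`|det|` reading of «−log det S»).

WHAT THIS FILE ADDS (theorems only; 0 `def`, 0 named facts, 0 `sorry`):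
* §1 [folklore, private] the sign of a determinant is constant along a segment of injective operators:
  `0 < det A · det(A + B)` if `A + tB` is injective for every `t ∈ [0, 1]` (intermediate value theorem for the
  polynomial `t ↦ det(A + tB)` on a finite-dimensional real space).
* §2 `R(vw)|_𝔤 = R(v)|_𝔤 ∘ R(w)|_𝔤` (`conjROn_mul`, `det_conjROn_mul`); **`det R(w²)|_𝔤 = (det R(w)|_𝔤)² = 1`** for
  `w ∈ U1` stabilising `𝔤` (`det_conjROn_eq_one_of_sq`, from `|det R(w)|_𝔤| = 1`, `abs_det_conjROn`); `e^X = (e^{X/2})²`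
  (`expUnit_half_mul_self`), hence `det R(e^X)|_𝔤 = 1` for `X ∈ 𝔤` when `e^𝔤 ⊆ H` (`det_conjROn_eq_one_of_exp`) and
  **`det R(u)|_𝔤 = 1` FOR EVERY `u ∈ H` WHEN `H = e^𝔤`** — print's «G is obtained by applying the function e^{iA} to
  A ∈ 𝔤» ([4] p. 20), hypothesis `hexp` (`det_conjROn_eq_one`).
* §3 THE SIGN OF `det S(V₀, b₀(c))|_𝔤` IS THE SIGN OF `det R(u)|_𝔤`, `u` the transporter: at a regular background
  (`‖W_x(V₀) − 1‖ ≦ ε ≦ 1/8` on `B(c₋)`, `50(d+1)ε < L^{−d}`) the segment `L·S₀ + t(S − L·S₀)`, `t ∈ [0, 1]`, consists of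
  injective operators (`‖L·S₀X‖ = L·L^{−d}‖X‖`, `norm_mainCoeff`; `‖(S − L·S₀)X‖ ≦ 50(d+1)εL‖X‖`,
  `norm_fullCoeff_sub_smul_mainCoeff_le` — (126) of [4]): `det_mainCoeffOn_eq` (`det S₀ = L^{−d·dim 𝔤}·det R(u)|_𝔤`),
  **`det_mainCoeffOn_mul_det_fullCoeffOn_pos`** (`0 < det S₀ · det S`), **`det_fullCoeffOn_pos_iff`**
  (`0 < det S ↔ 0 < det R(u)|_𝔤`).
* §4 FOR `H = e^𝔤 ≤ U1` (print's G): **`det_mainCoeffOn_eq_pow`** (`det S₀ = L^{−d·dim 𝔤}` EXACTLY, not only in absolute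
  value), **`det_fullCoeffOn_pos`** (`0 < det S(V₀, b₀(c))|_𝔤` — the local term `−log det S` of p. 271 is the logarithm
  of a positive number, `neg_log_det_fullCoeffOn_eq`: `−log det S = −log|det S|`), and **`det_fullCoeffOn_gaugeAct`**:
  `det S` ITSELF (not only `|det S|`, §9c of `B10Eq61SpineCoefficient`) is gauge invariant; §4b the same for the group
  of a log-chart (`det_fullCoeffOn_pos_of_logChart`, `h𝔤` and `hst` supplied by `B10Eq61CoefficientOnLie`).
* §5 `G = U(N)`, `𝔤 = 𝔲(N)`: `hexp` DISCHARGED by (23) of [4] in the tree's form `MatrixLog.exists_isHermitian_exp_eq`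
  (every unitary matrix is `e^{iA}`, `A` hermitian): `exists_skewAdjoint_expUnit_eq`, `det_conjROn_unitary_eq_one`,
  **`det_fullCoeffOn_pos_unitary`** (every hypothesis about `𝔤` and `G` discharged; chart radius `1/3`).
* §6 `G = SU(N)`, `𝔤 = 𝔰𝔲(N)` (print's semi-simple case): the square root `e^{iA/2}` of `u = e^{iA} ∈ SU(N)` is taken in
  `U(N)`, which also stabilises `𝔰𝔲(N)` (`conjR_mem_su_of_unitary`): `det_conjROn_specialUnitary_eq_one`,
  **`det_fullCoeffOn_pos_specialUnitary`** (chart radius `min(1/3, 3/N)` of the tree's `specialUnitaryLogChart`).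

HONEST SCOPE.  (i) The sign is derived under print's own description of the group, `G = e^𝔤` ([4] p. 20; for a compact
CONNECTED Lie group this is the surjectivity of the exponential map, [BrockerTomDieck1985] Ch. IV Thm. (2.2)), typed as
the hypothesis `hexp : ∀ u ∈ H, ∃ X ∈ 𝔤, e^X = u`, and discharged for `U(N)` and `SU(N)`; for a group NOT generated by
`e^𝔤` nothing is asserted beyond §3 (`sign det S = sign det R(u)|_𝔤`).  (ii) Regularity hypotheses exactly those of
`B10Eq61SpineCoefficient` §9d / `B10Eq61CoefficientOnLie` §5 (block loops at `c` within `ε ≦ 1/8`, `50(d+1)ε < L^{−d}`,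
within the chart radius); `ℤ^d` carrier, one averaging step (HONEST SCOPE (ii) there).  (iii) KIND (G.5-54 [i]): derived
member over the lineage's concrete objects — print writes «−log det S» without comment on the sign; this file shows the
determinant IS positive in print's setting, so that «det» and «|det|» readings agree there.  NOT summit progress.
-/

noncomputable section

open scoped BigOperators
open NormedSpace

namespace Literature.MathematicalPhysics.QuantumFieldTheory.Balaban1983to89.B10Eq61DetPositive

open B7Prop1Explicit B7Prop3GeneralRotated B7Eq125RightInverse
open B7Eq78Linearization (conjR conjR_apply)
open B7Prop2Explicit (hol_mem_of unitaryUnits mem_unitaryUnits unitaryUnits_le_U1)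
open B7Prop2SpecialUnitary (specialUnitaryUnits mem_specialUnitaryUnits specialUnitaryUnits_le_unitaryUnits
  specialUnitaryUnits_le_U1)
open B10Eq61SpineCoefficient (fullCoeff fullCoeffOn fullCoeffOn_apply mainCoeff mainCoeffOn mainCoeffOn_apply conjROn
  conjROn_apply abs_det_conjROn norm_mainCoeff norm_fullCoeff_sub_smul_mainCoeff_le fullCoeffOn_gaugeAct
  norm_Wcx_gaugeAct_sub_one fullCoeff_gaugeAct_mem)
open B10Eq61CoefficientOnLie (fullCoeff_mem_lie expUnit_mem_of_logChart fullCoeff_mem_skewAdjoint)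

-- `Site` alone would resolve to the torus sites of `Setup.lean`; re-export the `ℤ^d` sites of `B7Prop1Explicit`.
export B7Prop1Explicit (Site)

variable {d : ℕ}

/-! ## §1 [folklore] The sign of `det` is constant along a segment of injective operators -/

section Folklore

variable {E : Type*} [AddCommGroup E] [Module ℝ E] [FiniteDimensional ℝ E]

/-- `t ↦ det(A + tB)` is continuous (a polynomial in `t`: the determinant of the matrix `[A] + t[B]`). [folklore] -/
private theorem continuous_det_add_smul (A B : E →ₗ[ℝ] E) :
    Continuous fun t : ℝ => LinearMap.det (A + t • B) := by
  let b := Module.finBasis ℝ E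
  have h : (fun t : ℝ => LinearMap.det (A + t • B))
      = fun t : ℝ => (LinearMap.toMatrix b b A + t • LinearMap.toMatrix b b B).det := by
    funext t
    rw [← LinearMap.det_toMatrix b, map_add, map_smul]
  rw [h]
  exact (continuous_const.add (continuous_id.smul continuous_const)).matrix_det

/-- an injective endomorphism of a finite-dimensional space has `det ≠ 0`. [folklore] -/
private theorem det_ne_zero_of_injective {T : E →ₗ[ℝ] E} (h : Function.Injective T) : LinearMap.det T ≠ 0 :=
  (LinearMap.isUnit_det _ ((LinearMap.isUnit_iff_ker_eq_bot _).2 (LinearMap.ker_eq_bot.2 h))).ne_zero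

/-- **`0 < det A · det(A + B)` if `A + tB` is injective for all `t ∈ [0, 1]`**: `t ↦ det(A + tB)` is continuous and
never vanishes on `[0, 1]`, so it does not change sign (intermediate value theorem). [folklore] -/
private theorem det_mul_det_add_pos (A B : E →ₗ[ℝ] E)
    (hinj : ∀ t ∈ Set.Icc (0 : ℝ) 1, Function.Injective (A + t • B)) :
    0 < LinearMap.det A * LinearMap.det (A + B) := by
  set f : ℝ → ℝ := fun t => LinearMap.det (A + t • B) with hf
  have hcont : Continuous f := continuous_det_add_smul A B
  have hne : ∀ t ∈ Set.Icc (0 : ℝ) 1, f t ≠ 0 := fun t ht => det_ne_zero_of_injective (hinj t ht)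
  have hf0 : f 0 = LinearMap.det A := by simp only [hf, zero_smul, add_zero]
  have hf1 : f 1 = LinearMap.det (A + B) := by simp only [hf, one_smul]
  rw [← hf0, ← hf1]
  have h0 := hne 0 ⟨le_rfl, zero_le_one⟩
  have h1 := hne 1 ⟨zero_le_one, le_rfl⟩
  by_contra hle
  push Not at hle
  rcases lt_or_gt_of_ne h0 with h0neg | h0pos
  · have h1pos : 0 < f 1 := by
      rcases lt_or_gt_of_ne h1 with h1neg | h1pos
      · exact absurd (mul_pos_of_neg_of_neg h0neg h1neg) (not_lt.2 hle)
      · exact h1pos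
    obtain ⟨t, ht, hft⟩ :=
      intermediate_value_Icc (zero_le_one : (0 : ℝ) ≤ 1) hcont.continuousOn ⟨h0neg.le, h1pos.le⟩
    exact hne t ht hft
  · have h1neg : f 1 < 0 := by
      rcases lt_or_gt_of_ne h1 with h1neg | h1pos
      · exact h1neg
      · exact absurd (mul_pos h0pos h1pos) (not_lt.2 hle)
    obtain ⟨t, ht, hft⟩ :=
      intermediate_value_Icc' (zero_le_one : (0 : ℝ) ≤ 1) hcont.continuousOn ⟨h1neg.le, h0pos.le⟩
    exact hne t ht hft

end Folklore

/-! ## §2 `det R(u)|_𝔤 = 1` for squares, for exponentials, and on a group generated by `e^𝔤` ([4] p. 20) -/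

section Rotation

variable {𝔸 : Type*} [NormedRing 𝔸] [NormedAlgebra ℂ 𝔸]

/-- **`R(vw)|_𝔤 = R(v)|_𝔤 ∘ R(w)|_𝔤`** (`R(vw)X = v(wXw⁻¹)v⁻¹`, the lineage's `conjR_mul_left`).
[cite: Balaban1985Averaging, (56)–(57) p.27, (8) p.18] -/
theorem conjROn_mul (𝔤 : Submodule ℝ 𝔸) (v w : 𝔸ˣ) (hv : ∀ X ∈ 𝔤, conjR v X ∈ 𝔤) (hw : ∀ X ∈ 𝔤, conjR w X ∈ 𝔤)
    (hvw : ∀ X ∈ 𝔤, conjR (v * w) X ∈ 𝔤) :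
    conjROn 𝔤 (v * w) hvw = conjROn 𝔤 v hv ∘ₗ conjROn 𝔤 w hw :=
  LinearMap.ext fun X => Subtype.ext (by
    simp only [LinearMap.coe_comp, Function.comp_apply, conjROn_apply]
    exact conjR_mul_left v w X)

/-- hence **`det R(vw)|_𝔤 = det R(v)|_𝔤 · det R(w)|_𝔤`**. [cite: Balaban1985Averaging, (56)–(57) p.27; Balaban1985UV3, p.271 (after (62))] -/
theorem det_conjROn_mul (𝔤 : Submodule ℝ 𝔸) (v w : 𝔸ˣ) (hv : ∀ X ∈ 𝔤, conjR v X ∈ 𝔤)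
    (hw : ∀ X ∈ 𝔤, conjR w X ∈ 𝔤) (hvw : ∀ X ∈ 𝔤, conjR (v * w) X ∈ 𝔤) :
    LinearMap.det (conjROn 𝔤 (v * w) hvw) = LinearMap.det (conjROn 𝔤 v hv) * LinearMap.det (conjROn 𝔤 w hw) := by
  rw [conjROn_mul 𝔤 v w hv hw hvw, LinearMap.det_comp]

/-- **`det R(w²)|_𝔤 = 1`**: the square of a `𝔤`-stabilising `w ∈ U1` rotates `𝔤` with determinant
`(det R(w)|_𝔤)² = |det R(w)|_𝔤|² = 1` (`abs_det_conjROn`: `R(w)` is an isometry of `𝔤`).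
[cite: Balaban1985UV3, p.271 (after (62)); Balaban1985Averaging, (56)–(57) p.27] -/
theorem det_conjROn_eq_one_of_sq [NormOneClass 𝔸] (𝔤 : Submodule ℝ 𝔸) [FiniteDimensional ℝ 𝔤] {u w : 𝔸ˣ}
    (hwu : w * w = u) (hw1 : w ∈ U1 𝔸) (hw : ∀ X ∈ 𝔤, conjR w X ∈ 𝔤) (hu : ∀ X ∈ 𝔤, conjR u X ∈ 𝔤) :
    LinearMap.det (conjROn 𝔤 u hu) = 1 := by
  subst hwu
  rw [det_conjROn_mul 𝔤 w w hw hw hu, ← sq, ← sq_abs, abs_det_conjROn 𝔤 hw1 hw, one_pow]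

variable [CompleteSpace 𝔸]

omit [CompleteSpace 𝔸] in
/-- **`e^X = e^{X/2}·e^{X/2}`** as units: every exponential is a square of an exponential of the same line.
[cite: Balaban1985Averaging, p.20, (23) p.21] -/
theorem expUnit_half_mul_self [CompleteSpace 𝔸] (X : 𝔸) :
    expUnit ((2⁻¹ : ℝ) • X) * expUnit ((2⁻¹ : ℝ) • X) = expUnit X := by
  ext
  letI : NormedAlgebra ℚ 𝔸 := NormedAlgebra.restrictScalars ℚ ℂ 𝔸
  rw [Units.val_mul, val_expUnit, val_expUnit, ← exp_add_of_commute (Commute.refl _), ← add_smul,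
    show (2⁻¹ : ℝ) + 2⁻¹ = 1 by norm_num, one_smul]

/-- **`det R(e^X)|_𝔤 = 1` for `X ∈ 𝔤`** when `e^𝔤 ⊆ H ≤ U1` and `H` stabilises `𝔤`: `e^X` is the square of
`e^{X/2} ∈ H`. [cite: Balaban1985Averaging, p.20; Balaban1985UV3, p.271 (after (62))] -/
theorem det_conjROn_eq_one_of_exp [NormOneClass 𝔸] (𝔤 : Submodule ℝ 𝔸) [FiniteDimensional ℝ 𝔤]
    {H : Subgroup 𝔸ˣ} (hH : H ≤ U1 𝔸) (hst : ∀ u : 𝔸ˣ, u ∈ H → ∀ X ∈ 𝔤, conjR u X ∈ 𝔤)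
    (hE : ∀ X ∈ 𝔤, expUnit X ∈ H) {X : 𝔸} (hX : X ∈ 𝔤) {u : 𝔸ˣ} (huX : expUnit X = u)
    (hu : ∀ Y ∈ 𝔤, conjR u Y ∈ 𝔤) : LinearMap.det (conjROn 𝔤 u hu) = 1 :=
  have hwH : expUnit ((2⁻¹ : ℝ) • X) ∈ H := hE _ (𝔤.smul_mem _ hX)
  det_conjROn_eq_one_of_sq 𝔤 ((expUnit_half_mul_self X).trans huX) (hH hwH) (hst _ hwH) hu

/-- **`det R(u)|_𝔤 = 1` FOR EVERY `u ∈ G` WHEN «the group G is obtained by applying the function e^{iA} to A ∈ 𝔤»**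
([4] p. 20; hypothesis `hexp`; in the lineage's convention the `i` is absorbed: `𝔤` skew-hermitian, `u = e^X`).
[cite: Balaban1985Averaging, p.20; Balaban1985UV3, p.271 (after (62)); BrockerTomDieck1985, Ch. IV Thm. (2.2)] -/
theorem det_conjROn_eq_one [NormOneClass 𝔸] (𝔤 : Submodule ℝ 𝔸) [FiniteDimensional ℝ 𝔤] {H : Subgroup 𝔸ˣ}
    (hH : H ≤ U1 𝔸) (hst : ∀ u : 𝔸ˣ, u ∈ H → ∀ X ∈ 𝔤, conjR u X ∈ 𝔤) (hE : ∀ X ∈ 𝔤, expUnit X ∈ H)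
    (hexp : ∀ u : 𝔸ˣ, u ∈ H → ∃ X ∈ 𝔤, expUnit X = u) {u : 𝔸ˣ} (huH : u ∈ H)
    (hu : ∀ Y ∈ 𝔤, conjR u Y ∈ 𝔤) : LinearMap.det (conjROn 𝔤 u hu) = 1 := by
  obtain ⟨X, hX, hXu⟩ := hexp u huH
  exact det_conjROn_eq_one_of_exp 𝔤 hH hst hE hX hXu hu

end Rotation

/-! ## §3 The sign of `det S(V₀, b₀(c))|_𝔤` is the sign of `det R(u)|_𝔤`, `u = V₀([c₋, b₀(c)₋])` the transporter
((124)–(126) of [4]: the main term dominates at a regular background) -/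

section Coefficient

variable {𝔸 : Type*} [NormedRing 𝔸] [NormedAlgebra ℂ 𝔸] [NormOneClass 𝔸]
variable {L : ℕ}

/-- **`det S₀(V₀, b₀(c))|_𝔤 = L^{−d·dim 𝔤} · det R(u)|_𝔤`**, `u = V₀([c₋, b₀(c)₋])` (the main-term block IS
`L^{−d}·R(u)` restricted to `𝔤`). [cite: Balaban1985UV3, p.271 (after (62)); Balaban1985Averaging, (125) p.36] -/
theorem det_mainCoeffOn_eq (𝔤 : Submodule ℝ 𝔸) [FiniteDimensional ℝ 𝔤] {H : Subgroup 𝔸ˣ}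
    (hst : ∀ u : 𝔸ˣ, u ∈ H → ∀ X ∈ 𝔤, conjR u X ∈ 𝔤) {V₀ : Site d → Fin d → 𝔸ˣ} (hV₀ : ∀ x κ, V₀ x κ ∈ H)
    (y : Site d) (κ : Fin d) :
    LinearMap.det (mainCoeffOn L 𝔤 hst hV₀ y κ)
      = (((L : ℝ) ^ d)⁻¹) ^ Module.finrank ℝ 𝔤
        * LinearMap.det (conjROn 𝔤 (hol V₀ (corner L y) (seg κ (((L - 1 : ℕ) : ℤ))))
            (hst _ (hol_mem_of hV₀ _ _))) := by
  unfold mainCoeffOn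
  rw [LinearMap.det_smul]

variable [CompleteSpace 𝔸]

/-- **`0 < det S₀(V₀, b₀(c))|_𝔤 · det S(V₀, b₀(c))|_𝔤` AT A REGULAR BACKGROUND** (`H ≤ U1`-valued, block loops at `c`
within `ε ≦ 1/8` of `1`, `50(d+1)ε < L^{−d}`, `S𝔤 ⊆ 𝔤`): along the segment `L·S₀ + t(S − L·S₀)`, `t ∈ [0, 1]`, every
operator is injective on `𝔤` — `‖L·S₀X‖ = L·L^{−d}‖X‖` (`norm_mainCoeff`) beats `‖t(S − L·S₀)X‖ ≦ 50(d+1)εL‖X‖`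
((126) of [4], `norm_fullCoeff_sub_smul_mainCoeff_le`) — so `det` keeps its sign from `L·S₀` to `S` (§1).
[cite: Balaban1985UV3, p.271 (after (62)); Balaban1985Averaging, (124)–(126) p.36; Balaban1985BackgroundPropagators, p.428 (after (3.156))] -/
theorem det_mainCoeffOn_mul_det_fullCoeffOn_pos (hL : 1 ≤ L) (𝔤 : Submodule ℝ 𝔸) [FiniteDimensional ℝ 𝔤]
    {H : Subgroup 𝔸ˣ} (hH : H ≤ U1 𝔸) (hst : ∀ u : 𝔸ˣ, u ∈ H → ∀ X ∈ 𝔤, conjR u X ∈ 𝔤)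
    {V₀ : Site d → Fin d → 𝔸ˣ} (hV₀ : ∀ x κ, V₀ x κ ∈ H) (y : Site d) (κ : Fin d) {ε : ℝ} (hε0 : 0 ≤ ε)
    (hε : ε ≤ 1 / 8)
    (hW : ∀ r : Fin d → Fin L, ‖((Wcx L V₀ (corner L y) κ (boxVec L r) : 𝔸ˣ) : 𝔸) - 1‖ ≤ ε)
    (hsmall : 50 * (d + 1) * ε < (((L : ℝ) ^ d)⁻¹))
    (hW1 : ∀ r : Fin d → Fin L, ‖((Wcx L V₀ (corner L y) κ (boxVec L r) : 𝔸ˣ) : 𝔸) - 1‖ < 1)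
    (h𝔤 : ∀ X ∈ 𝔤, fullCoeff L V₀ y κ X ∈ 𝔤) :
    0 < LinearMap.det (mainCoeffOn L 𝔤 hst hV₀ y κ) * LinearMap.det (fullCoeffOn L 𝔤 V₀ y κ hW1 h𝔤) := by
  have hU : ∀ x κ, V₀ x κ ∈ U1 𝔸 := fun x κ => hH (hV₀ x κ)
  have hLpos : (0 : ℝ) < L := by exact_mod_cast hL
  have hc : 0 < (L : ℝ) * ((((L : ℝ) ^ d)⁻¹) - 50 * (d + 1) * ε) := mul_pos hLpos (by linarith)
  set S := fullCoeffOn L 𝔤 V₀ y κ hW1 h𝔤 with hS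
  set S₀ := mainCoeffOn L 𝔤 hst hV₀ y κ with hS₀
  have hinj : ∀ t ∈ Set.Icc (0 : ℝ) 1, Function.Injective ((L : ℝ) • S₀ + t • (S - (L : ℝ) • S₀)) := by
    intro t ht
    rw [injective_iff_map_eq_zero]
    intro X hX
    have hval : ((((L : ℝ) • S₀ + t • (S - (L : ℝ) • S₀)) X : 𝔤) : 𝔸)
        = (L : ℝ) • mainCoeff L V₀ y κ X
          + t • (fullCoeff L V₀ y κ X - (L : ℝ) • mainCoeff L V₀ y κ X) := by
      simp only [hS, hS₀, LinearMap.add_apply, LinearMap.smul_apply, LinearMap.sub_apply, Submodule.coe_add,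
        Submodule.coe_smul, Submodule.coe_sub, fullCoeffOn_apply, mainCoeffOn_apply]
    have h1 : ‖(L : ℝ) • mainCoeff L V₀ y κ X‖ = (L : ℝ) * ((((L : ℝ) ^ d)⁻¹) * ‖(X : 𝔸)‖) := by
      rw [norm_smul, norm_mainCoeff hL hU, Real.norm_of_nonneg hLpos.le]
    have h2 : ‖t • (fullCoeff L V₀ y κ X - (L : ℝ) • mainCoeff L V₀ y κ X)‖
        ≤ 50 * (d + 1) * ε * L * ‖(X : 𝔸)‖ := by
      rw [norm_smul, Real.norm_of_nonneg ht.1]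
      have h := norm_fullCoeff_sub_smul_mainCoeff_le hL hU y κ hε0 hε hW (X : 𝔸)
      have h' : 0 ≤ ‖fullCoeff L V₀ y κ X - (L : ℝ) • mainCoeff L V₀ y κ X‖ := norm_nonneg _
      nlinarith [ht.2]
    have h3 : ‖(L : ℝ) • mainCoeff L V₀ y κ X‖
        ≤ ‖t • (fullCoeff L V₀ y κ X - (L : ℝ) • mainCoeff L V₀ y κ X)‖ := by
      have h0 : (L : ℝ) • mainCoeff L V₀ y κ X
          + t • (fullCoeff L V₀ y κ X - (L : ℝ) • mainCoeff L V₀ y κ X) = 0 := by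
        rw [← hval, hX, Submodule.coe_zero]
      calc ‖(L : ℝ) • mainCoeff L V₀ y κ X‖
          = ‖((L : ℝ) • mainCoeff L V₀ y κ X
              + t • (fullCoeff L V₀ y κ X - (L : ℝ) • mainCoeff L V₀ y κ X))
              - t • (fullCoeff L V₀ y κ X - (L : ℝ) • mainCoeff L V₀ y κ X)‖ := by
            rw [add_sub_cancel_right]
        _ ≤ ‖(L : ℝ) • mainCoeff L V₀ y κ X
              + t • (fullCoeff L V₀ y κ X - (L : ℝ) • mainCoeff L V₀ y κ X)‖
              + ‖t • (fullCoeff L V₀ y κ X - (L : ℝ) • mainCoeff L V₀ y κ X)‖ := norm_sub_le _ _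
        _ = ‖t • (fullCoeff L V₀ y κ X - (L : ℝ) • mainCoeff L V₀ y κ X)‖ := by
            rw [h0, norm_zero, zero_add]
    have hXn : ‖(X : 𝔸)‖ ≤ 0 := by
      by_contra hpos
      push Not at hpos
      have h4 : (L : ℝ) * ((((L : ℝ) ^ d)⁻¹) - 50 * (d + 1) * ε) * ‖(X : 𝔸)‖ ≤ 0 := by nlinarith [h1, h2, h3]
      exact absurd h4 (not_le.2 (mul_pos hc hpos))
    have hX0 : (X : 𝔸) = 0 := norm_eq_zero.1 (le_antisymm hXn (norm_nonneg _))
    exact Subtype.ext (by rw [Submodule.coe_zero]; exact hX0)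
  have hpath := det_mul_det_add_pos ((L : ℝ) • S₀) (S - (L : ℝ) • S₀) hinj
  rw [add_sub_cancel, LinearMap.det_smul, mul_assoc] at hpath
  exact pos_of_mul_pos_right hpath (pow_pos hLpos _).le

/-- **`0 < det S(V₀, b₀(c))|_𝔤 ↔ 0 < det R(V₀([c₋, b₀(c)₋]))|_𝔤`** at a regular background: the sign of the
determinant of the full coefficient is that of the rotation by the spine transporter (`det S₀ = L^{−d·dim 𝔤}·det R(u)`,
`det_mainCoeffOn_eq`). [cite: Balaban1985UV3, p.271 (after (62)); Balaban1985Averaging, (124)–(126) p.36] -/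
theorem det_fullCoeffOn_pos_iff (hL : 1 ≤ L) (𝔤 : Submodule ℝ 𝔸) [FiniteDimensional ℝ 𝔤]
    {H : Subgroup 𝔸ˣ} (hH : H ≤ U1 𝔸) (hst : ∀ u : 𝔸ˣ, u ∈ H → ∀ X ∈ 𝔤, conjR u X ∈ 𝔤)
    {V₀ : Site d → Fin d → 𝔸ˣ} (hV₀ : ∀ x κ, V₀ x κ ∈ H) (y : Site d) (κ : Fin d) {ε : ℝ} (hε0 : 0 ≤ ε)
    (hε : ε ≤ 1 / 8)
    (hW : ∀ r : Fin d → Fin L, ‖((Wcx L V₀ (corner L y) κ (boxVec L r) : 𝔸ˣ) : 𝔸) - 1‖ ≤ ε)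
    (hsmall : 50 * (d + 1) * ε < (((L : ℝ) ^ d)⁻¹))
    (hW1 : ∀ r : Fin d → Fin L, ‖((Wcx L V₀ (corner L y) κ (boxVec L r) : 𝔸ˣ) : 𝔸) - 1‖ < 1)
    (h𝔤 : ∀ X ∈ 𝔤, fullCoeff L V₀ y κ X ∈ 𝔤) :
    0 < LinearMap.det (fullCoeffOn L 𝔤 V₀ y κ hW1 h𝔤)
      ↔ 0 < LinearMap.det (conjROn 𝔤 (hol V₀ (corner L y) (seg κ (((L - 1 : ℕ) : ℤ))))
            (hst _ (hol_mem_of hV₀ _ _))) := by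
  have h := det_mainCoeffOn_mul_det_fullCoeffOn_pos hL 𝔤 hH hst hV₀ y κ hε0 hε hW hsmall hW1 h𝔤
  rw [det_mainCoeffOn_eq, mul_assoc] at h
  have hLpos : (0 : ℝ) < L := by exact_mod_cast hL
  have h' := pos_of_mul_pos_right h (pow_pos (inv_pos.2 (pow_pos hLpos d)) _).le
  constructor
  · exact fun hS => pos_of_mul_pos_left h' hS.le
  · exact fun hR => pos_of_mul_pos_right h' hR.le

/-! ## §4 For `H = e^𝔤 ≤ U1` (print's `G`, [4] p. 20): `det S₀ = L^{−d·dim 𝔤}`, `det S > 0`, `det S` gauge invariant -/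

/-- **`det S₀(V₀, b₀(c))|_𝔤 = L^{−d·dim 𝔤}` EXACTLY** (not only in absolute value, `abs_det_mainCoeffOn`) for a
background with values in `H = e^𝔤 ≤ U1`. [cite: Balaban1985UV3, p.271 (after (62)); Balaban1985Averaging, (125) p.36, p.20] -/
theorem det_mainCoeffOn_eq_pow (𝔤 : Submodule ℝ 𝔸) [FiniteDimensional ℝ 𝔤] {H : Subgroup 𝔸ˣ} (hH : H ≤ U1 𝔸)
    (hst : ∀ u : 𝔸ˣ, u ∈ H → ∀ X ∈ 𝔤, conjR u X ∈ 𝔤) (hE : ∀ X ∈ 𝔤, expUnit X ∈ H)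
    (hexp : ∀ u : 𝔸ˣ, u ∈ H → ∃ X ∈ 𝔤, expUnit X = u) {V₀ : Site d → Fin d → 𝔸ˣ} (hV₀ : ∀ x κ, V₀ x κ ∈ H)
    (y : Site d) (κ : Fin d) :
    LinearMap.det (mainCoeffOn L 𝔤 hst hV₀ y κ) = (((L : ℝ) ^ d)⁻¹) ^ Module.finrank ℝ 𝔤 := by
  rw [det_mainCoeffOn_eq, det_conjROn_eq_one 𝔤 hH hst hE hexp (hol_mem_of hV₀ _ _), mul_one]

/-- hence **`0 < det S₀(V₀, b₀(c))|_𝔤`**. [cite: Balaban1985UV3, p.271 (after (62))] -/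
theorem det_mainCoeffOn_pos (hL : 1 ≤ L) (𝔤 : Submodule ℝ 𝔸) [FiniteDimensional ℝ 𝔤] {H : Subgroup 𝔸ˣ}
    (hH : H ≤ U1 𝔸) (hst : ∀ u : 𝔸ˣ, u ∈ H → ∀ X ∈ 𝔤, conjR u X ∈ 𝔤) (hE : ∀ X ∈ 𝔤, expUnit X ∈ H)
    (hexp : ∀ u : 𝔸ˣ, u ∈ H → ∃ X ∈ 𝔤, expUnit X = u) {V₀ : Site d → Fin d → 𝔸ˣ} (hV₀ : ∀ x κ, V₀ x κ ∈ H)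
    (y : Site d) (κ : Fin d) : 0 < LinearMap.det (mainCoeffOn L 𝔤 hst hV₀ y κ) := by
  have hLpos : (0 : ℝ) < L := by exact_mod_cast hL
  rw [det_mainCoeffOn_eq_pow 𝔤 hH hst hE hexp hV₀ y κ]
  exact pow_pos (inv_pos.2 (pow_pos hLpos d)) _

/-- **`0 < det S(V₀, b₀(c))|_𝔤` — THE LOCAL TERM `−log det S(V_k^{(k)}, b₀(c))` OF p. 271 IS THE LOGARITHM OF A POSITIVE
NUMBER**, for every background with values in print's group `G = e^𝔤 ≤ U1` ([4] p. 20), regular at `c` (block loops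
within `ε ≦ 1/8`, `50(d+1)ε < L^{−d}`), on any finite-dimensional `S`-stable `𝔤`: the sign of `det S` is the sign of
`det R(u)|_𝔤 = 1` (§2–§3). [cite: Balaban1985UV3, p.271 (after (62)); Balaban1985Averaging, p.20, (124)–(126) p.36; Balaban1985BackgroundPropagators, p.428 (after (3.156))] -/
theorem det_fullCoeffOn_pos (hL : 1 ≤ L) (𝔤 : Submodule ℝ 𝔸) [FiniteDimensional ℝ 𝔤]
    {H : Subgroup 𝔸ˣ} (hH : H ≤ U1 𝔸) (hst : ∀ u : 𝔸ˣ, u ∈ H → ∀ X ∈ 𝔤, conjR u X ∈ 𝔤)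
    (hE : ∀ X ∈ 𝔤, expUnit X ∈ H) (hexp : ∀ u : 𝔸ˣ, u ∈ H → ∃ X ∈ 𝔤, expUnit X = u)
    {V₀ : Site d → Fin d → 𝔸ˣ} (hV₀ : ∀ x κ, V₀ x κ ∈ H) (y : Site d) (κ : Fin d) {ε : ℝ} (hε0 : 0 ≤ ε)
    (hε : ε ≤ 1 / 8)
    (hW : ∀ r : Fin d → Fin L, ‖((Wcx L V₀ (corner L y) κ (boxVec L r) : 𝔸ˣ) : 𝔸) - 1‖ ≤ ε)
    (hsmall : 50 * (d + 1) * ε < (((L : ℝ) ^ d)⁻¹))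
    (hW1 : ∀ r : Fin d → Fin L, ‖((Wcx L V₀ (corner L y) κ (boxVec L r) : 𝔸ˣ) : 𝔸) - 1‖ < 1)
    (h𝔤 : ∀ X ∈ 𝔤, fullCoeff L V₀ y κ X ∈ 𝔤) :
    0 < LinearMap.det (fullCoeffOn L 𝔤 V₀ y κ hW1 h𝔤) :=
  (det_fullCoeffOn_pos_iff hL 𝔤 hH hst hV₀ y κ hε0 hε hW hsmall hW1 h𝔤).2 (by
    rw [det_conjROn_eq_one 𝔤 hH hst hE hexp (hol_mem_of hV₀ _ _)]
    exact one_pos)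

/-- … so **«−log det S» = «−log|det S|»** there: the `det` and `|det|` readings of the local term agree in print's
setting. [cite: Balaban1985UV3, p.271 (after (62))] -/
theorem neg_log_det_fullCoeffOn_eq (hL : 1 ≤ L) (𝔤 : Submodule ℝ 𝔸) [FiniteDimensional ℝ 𝔤]
    {H : Subgroup 𝔸ˣ} (hH : H ≤ U1 𝔸) (hst : ∀ u : 𝔸ˣ, u ∈ H → ∀ X ∈ 𝔤, conjR u X ∈ 𝔤)
    (hE : ∀ X ∈ 𝔤, expUnit X ∈ H) (hexp : ∀ u : 𝔸ˣ, u ∈ H → ∃ X ∈ 𝔤, expUnit X = u)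
    {V₀ : Site d → Fin d → 𝔸ˣ} (hV₀ : ∀ x κ, V₀ x κ ∈ H) (y : Site d) (κ : Fin d) {ε : ℝ} (hε0 : 0 ≤ ε)
    (hε : ε ≤ 1 / 8)
    (hW : ∀ r : Fin d → Fin L, ‖((Wcx L V₀ (corner L y) κ (boxVec L r) : 𝔸ˣ) : 𝔸) - 1‖ ≤ ε)
    (hsmall : 50 * (d + 1) * ε < (((L : ℝ) ^ d)⁻¹))
    (hW1 : ∀ r : Fin d → Fin L, ‖((Wcx L V₀ (corner L y) κ (boxVec L r) : 𝔸ˣ) : 𝔸) - 1‖ < 1)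
    (h𝔤 : ∀ X ∈ 𝔤, fullCoeff L V₀ y κ X ∈ 𝔤) :
    -Real.log (LinearMap.det (fullCoeffOn L 𝔤 V₀ y κ hW1 h𝔤))
      = -Real.log |LinearMap.det (fullCoeffOn L 𝔤 V₀ y κ hW1 h𝔤)| := by
  rw [abs_of_pos (det_fullCoeffOn_pos hL 𝔤 hH hst hE hexp hV₀ y κ hε0 hε hW hsmall hW1 h𝔤)]

/-- **`det S(V_k^{(k)}, b₀(c))|_𝔤` ITSELF IS GAUGE INVARIANT** for `H = e^𝔤`-valued gauge transformations (§9c of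
`B10Eq61SpineCoefficient` had `|det S|`): `S(V₀^g) = R(g(c₋)) S(V₀) R(g(b₀(c)₋))⁻¹` on `𝔤` (`fullCoeffOn_gaugeAct`) and
both rotations have determinant `1` (§2). [cite: Balaban1985UV3, p.271 (after (62)); Balaban1985Averaging, (8) p.18, p.20, (45) p.24] -/
theorem det_fullCoeffOn_gaugeAct (𝔤 : Submodule ℝ 𝔸) [FiniteDimensional ℝ 𝔤] {H : Subgroup 𝔸ˣ}
    (hH : H ≤ U1 𝔸) (hst : ∀ u : 𝔸ˣ, u ∈ H → ∀ X ∈ 𝔤, conjR u X ∈ 𝔤) (hE : ∀ X ∈ 𝔤, expUnit X ∈ H)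
    (hexp : ∀ u : 𝔸ˣ, u ∈ H → ∃ X ∈ 𝔤, expUnit X = u)
    {u : Site d → 𝔸ˣ} (hu : ∀ x, u x ∈ H) (V₀ : Site d → Fin d → 𝔸ˣ) (y : Site d) (κ : Fin d)
    (hW : ∀ r : Fin d → Fin L, ‖((Wcx L V₀ (corner L y) κ (boxVec L r) : 𝔸ˣ) : 𝔸) - 1‖ < 1)
    (h𝔤 : ∀ X ∈ 𝔤, fullCoeff L V₀ y κ X ∈ 𝔤) :
    LinearMap.det (fullCoeffOn L 𝔤 (gaugeAct u V₀) y κ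
        (fun r => (norm_Wcx_gaugeAct_sub_one (fun x => hH (hu x)) V₀ _ κ _).trans_lt (hW r))
        (fullCoeff_gaugeAct_mem 𝔤 hst hu V₀ y κ h𝔤))
      = LinearMap.det (fullCoeffOn L 𝔤 V₀ y κ hW h𝔤) := by
  rw [fullCoeffOn_gaugeAct 𝔤 hst hu V₀ y κ hW h𝔤, LinearMap.det_comp, LinearMap.det_comp,
    det_conjROn_eq_one 𝔤 hH hst hE hexp (hu _), det_conjROn_eq_one 𝔤 hH hst hE hexp (H.inv_mem (hu _)),
    one_mul, mul_one]

end Coefficient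

/-! ## §4b The group of a log-chart (`B10Eq61CoefficientOnLie`: `h𝔤`, `hst`, (E) supplied) generated by `e^𝔤` -/

section Chart

variable {𝔸 : Type*} [NormedRing 𝔸] [NormedAlgebra ℂ 𝔸] [NormOneClass 𝔸] [CompleteSpace 𝔸]
variable {L : ℕ} {H : Subgroup 𝔸ˣ}

/-- **`0 < det S(V_k^{(k)}, b₀(c))|_𝔤` ON THE LIE ALGEBRA OF THE GAUGE GROUP**, for the group `H ≤ U1` of a log-chart
`G` generated by `e^𝔤` (`hexp`, [4] p. 20), at an `H`-valued background regular at `c` (block loops within `ε ≦ 1/8`,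
`50(d+1)ε < L^{−d}`, and within `ρ_G`) — the `S`-stability of `𝔤 = G.lie` and `Ad(H)𝔤 ⊆ 𝔤` being derived
(`B10Eq61CoefficientOnLie.fullCoeff_mem_lie`, `LogChart.conjR_mem_lie`).
[cite: Balaban1985UV3, p.271 (after (62)); Balaban1985Averaging, p.20, (124)–(126) p.36; Hall2015, Thm. 3.42] -/
theorem det_fullCoeffOn_pos_of_logChart (hL : 1 ≤ L) (G : LogChart 𝔸) [FiniteDimensional ℝ G.lie]
    (hHG : ∀ u : 𝔸ˣ, u ∈ H ↔ (u : 𝔸) ∈ G.carrier) (hH : H ≤ U1 𝔸)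
    (hexp : ∀ u : 𝔸ˣ, u ∈ H → ∃ X ∈ G.lie, expUnit X = u)
    {V₀ : Site d → Fin d → 𝔸ˣ} (hV₀ : ∀ z μ, V₀ z μ ∈ H) (y : Site d) (κ : Fin d) {ε : ℝ} (hε0 : 0 ≤ ε) (hε : ε ≤ 1 / 8)
    (hW : ∀ r : Fin d → Fin L, ‖((Wcx L V₀ (corner L y) κ (boxVec L r) : 𝔸ˣ) : 𝔸) - 1‖ ≤ ε)
    (hsmall : 50 * (d + 1) * ε < (((L : ℝ) ^ d)⁻¹))
    (hW1 : ∀ r : Fin d → Fin L, ‖((Wcx L V₀ (corner L y) κ (boxVec L r) : 𝔸ˣ) : 𝔸) - 1‖ < 1)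
    (hWρ : ∀ r : Fin d → Fin L, ‖((Wcx L V₀ (corner L y) κ (boxVec L r) : 𝔸ˣ) : 𝔸) - 1‖ < G.ρ) :
    0 < LinearMap.det (fullCoeffOn L G.lie V₀ y κ hW1 (fullCoeff_mem_lie G hHG hV₀ y κ hW1 hWρ)) :=
  det_fullCoeffOn_pos hL G.lie hH (G.conjR_mem_lie hHG) (expUnit_mem_of_logChart G hHG) hexp hV₀ y κ hε0 hε hW
    hsmall hW1 _

end Chart

/-! ## §5 `G = U(N)`, `𝔤 = 𝔲(N)`: `hexp` is (23) of [4] — every unitary matrix is `e^{iA}`, `A` hermitian -/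

section Unitary

open scoped Matrix.Norms.L2Operator

variable {n : Type*} [Fintype n] [DecidableEq n]
variable {L : ℕ}

/-- **(23) of [4] for `U(N)`, as units**: every `u ∈ U(N)` is `e^X` with `X = iA ∈ 𝔲(N)` (`A` hermitian; the tree's
`MatrixLog.exists_isHermitian_exp_eq`, `−1 ∈ σ(u)` allowed). [cite: Balaban1985Averaging, (23) p.21, p.20] -/
theorem exists_skewAdjoint_expUnit_eq {u : (Matrix n n ℂ)ˣ} (hu : u ∈ unitaryUnits (Matrix n n ℂ)) :
    ∃ X ∈ skewAdjoint.submodule ℝ (Matrix n n ℂ), expUnit X = u := by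
  obtain ⟨A, hA, -, hexp, -⟩ := MatrixLog.exists_isHermitian_exp_eq (mem_unitaryUnits.1 hu)
  refine ⟨Complex.I • A, ?_, Units.ext (by rw [val_expUnit, hexp])⟩
  show Complex.I • A ∈ skewAdjoint (Matrix n n ℂ)
  rw [skewAdjoint.mem_iff, star_smul, Matrix.star_eq_conjTranspose, hA.eq, Complex.star_def, Complex.conj_I,
    neg_smul]

variable [Nonempty n]

/-- **`det R(u)|_{𝔲(N)} = 1` for every unitary `u`** (`u = (e^{iA/2})²`). [cite: Balaban1985Averaging, (23) p.21, (56)–(57) p.27; Balaban1985UV3, p.271 (after (62))] -/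
theorem det_conjROn_unitary_eq_one {u : (Matrix n n ℂ)ˣ} (hu : u ∈ unitaryUnits (Matrix n n ℂ))
    (hst : ∀ X ∈ skewAdjoint.submodule ℝ (Matrix n n ℂ), conjR u X ∈ skewAdjoint.submodule ℝ (Matrix n n ℂ)) :
    LinearMap.det (conjROn (skewAdjoint.submodule ℝ (Matrix n n ℂ)) u hst) = 1 := by
  letI : CStarAlgebra (Matrix n n ℂ) := {}
  obtain ⟨X, hX, hXu⟩ := exists_skewAdjoint_expUnit_eq hu
  exact det_conjROn_eq_one_of_exp (H := unitaryUnits (Matrix n n ℂ)) _ unitaryUnits_le_U1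
    ((unitaryLogChart n).conjR_mem_lie fun _ => mem_unitaryUnits)
    (expUnit_mem_of_logChart (unitaryLogChart n) fun _ => mem_unitaryUnits) hX hXu hst

/-- **`0 < det S(V₀, b₀(c))|_{𝔲(N)}` FOR UNITARY BACKGROUNDS** regular at `c` (block loops within `ε ≦ 1/8` of `1` in the
operator norm (19), `50(d+1)ε < L^{−d}`): every hypothesis about `𝔤` and `G` of §4 discharged (`S𝔲(N) ⊆ 𝔲(N)` by
`B10Eq61CoefficientOnLie.fullCoeff_mem_skewAdjoint`, chart radius `1/3`; `U(N) = e^{𝔲(N)}` by (23)).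
[cite: Balaban1985UV3, p.271 (after (62)); Balaban1985Averaging, p.20, (19) p.21, (23) p.21, (124)–(126) p.36; Balaban1985BackgroundPropagators, p.428 (after (3.156))] -/
theorem det_fullCoeffOn_pos_unitary (hL : 1 ≤ L) {V₀ : Site d → Fin d → (Matrix n n ℂ)ˣ}
    (hV₀ : ∀ z μ, V₀ z μ ∈ unitaryUnits (Matrix n n ℂ)) (y : Site d) (κ : Fin d) {ε : ℝ} (hε0 : 0 ≤ ε)
    (hε : ε ≤ 1 / 8)
    (hW : ∀ r : Fin d → Fin L, ‖((Wcx L V₀ (corner L y) κ (boxVec L r) : (Matrix n n ℂ)ˣ) : Matrix n n ℂ) - 1‖ ≤ ε)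
    (hsmall : 50 * (d + 1) * ε < (((L : ℝ) ^ d)⁻¹))
    (hW1 : ∀ r : Fin d → Fin L, ‖((Wcx L V₀ (corner L y) κ (boxVec L r) : (Matrix n n ℂ)ˣ) : Matrix n n ℂ) - 1‖ < 1) :
    0 < LinearMap.det (fullCoeffOn L (skewAdjoint.submodule ℝ (Matrix n n ℂ)) V₀ y κ hW1
        (fullCoeff_mem_skewAdjoint hV₀ y κ fun r => (hW r).trans_lt (by linarith))) := by
  letI : CStarAlgebra (Matrix n n ℂ) := {}
  exact det_fullCoeffOn_pos (H := unitaryUnits (Matrix n n ℂ)) hL _ unitaryUnits_le_U1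
    ((unitaryLogChart n).conjR_mem_lie fun _ => mem_unitaryUnits)
    (expUnit_mem_of_logChart (unitaryLogChart n) fun _ => mem_unitaryUnits)
    (fun u hu => exists_skewAdjoint_expUnit_eq hu) hV₀ y κ hε0 hε hW hsmall hW1 _

end Unitary

/-! ## §6 `G = SU(N)`, `𝔤 = 𝔰𝔲(N)` (print's semi-simple case, [B10] Thm. 1): square roots taken in `U(N) ⊇ SU(N)` -/

section SpecialUnitary

open scoped Matrix.Norms.L2Operator

variable {n : Type*} [Fintype n] [DecidableEq n] [Nonempty n]
variable {L : ℕ}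

/-- **`Ad(U(N))` PRESERVES `𝔰𝔲(N)`**: for a unitary `w` and `X ∈ 𝔰𝔲(N) = {X* = −X} ∩ ker tr`, `wXw⁻¹ ∈ 𝔰𝔲(N)`
(skew-hermitian by the `U(N)` chart, traceless by cyclicity of the trace). [cite: Balaban1985Averaging, (8) p.18, p.20] -/
theorem conjR_mem_su_of_unitary {w : (Matrix n n ℂ)ˣ} (hw : w ∈ unitaryUnits (Matrix n n ℂ)) :
    ∀ X ∈ (specialUnitaryLogChart n).lie, conjR w X ∈ (specialUnitaryLogChart n).lie := by
  intro X hX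
  have hX' := hX
  simp only [specialUnitaryLogChart, Submodule.mem_inf, Submodule.restrictScalars_mem, LinearMap.mem_ker,
    Matrix.traceLinearMap_apply] at hX' ⊢
  refine ⟨(unitaryLogChart n).conjR_mem_lie (H := unitaryUnits (Matrix n n ℂ)) (fun _ => mem_unitaryUnits) w hw X
    hX'.1, ?_⟩
  rw [conjR_apply, Matrix.trace_mul_cycle, Units.inv_mul, one_mul]
  exact hX'.2

/-- **`det R(u)|_{𝔰𝔲(N)} = 1` for every `u ∈ SU(N)`**: `u = e^{iA} = (e^{iA/2})²` with `e^{iA/2} ∈ U(N)` stabilising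
`𝔰𝔲(N)` (the root need not lie in `SU(N)`). [cite: Balaban1985Averaging, (23) p.21, p.20, (56)–(57) p.27; Balaban1985UV3, p.271 (after (62))] -/
theorem det_conjROn_specialUnitary_eq_one {u : (Matrix n n ℂ)ˣ} (hu : u ∈ specialUnitaryUnits n)
    (hst : ∀ X ∈ (specialUnitaryLogChart n).lie, conjR u X ∈ (specialUnitaryLogChart n).lie) :
    LinearMap.det (conjROn (specialUnitaryLogChart n).lie u hst) = 1 := by
  letI : CStarAlgebra (Matrix n n ℂ) := {}
  obtain ⟨X, hX, hXu⟩ := exists_skewAdjoint_expUnit_eq (specialUnitaryUnits_le_unitaryUnits hu)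
  have hw : expUnit ((2⁻¹ : ℝ) • X) ∈ unitaryUnits (Matrix n n ℂ) :=
    expUnit_mem_of_logChart (H := unitaryUnits (Matrix n n ℂ)) (unitaryLogChart n) (fun _ => mem_unitaryUnits) _
      ((skewAdjoint.submodule ℝ (Matrix n n ℂ)).smul_mem _ hX)
  exact det_conjROn_eq_one_of_sq _ ((expUnit_half_mul_self X).trans hXu) (unitaryUnits_le_U1 hw)
    (conjR_mem_su_of_unitary hw) hst

/-- **`0 < det S(V₀, b₀(c))|_{𝔰𝔲(N)}` FOR `SU(N)`-VALUED BACKGROUNDS** regular at `c` (block loops within `ε ≦ 1/8`,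
`50(d+1)ε < L^{−d}`, and within the `SU(N)` chart radius `min(1/3, 3/N)` of the tree's `specialUnitaryLogChart`):
print's semi-simple compact case, the local term `−log det S` a logarithm of a positive number.
[cite: Balaban1985UV3, Thm. 1 p.257, p.271 (after (62)); Balaban1985Averaging, p.20, (23) p.21, (124)–(126) p.36; Balaban1985BackgroundPropagators, p.428 (after (3.156))] -/
theorem det_fullCoeffOn_pos_specialUnitary (hL : 1 ≤ L) {V₀ : Site d → Fin d → (Matrix n n ℂ)ˣ}
    (hV₀ : ∀ z μ, V₀ z μ ∈ specialUnitaryUnits n) (y : Site d) (κ : Fin d) {ε : ℝ} (hε0 : 0 ≤ ε)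
    (hε : ε ≤ 1 / 8)
    (hW : ∀ r : Fin d → Fin L, ‖((Wcx L V₀ (corner L y) κ (boxVec L r) : (Matrix n n ℂ)ˣ) : Matrix n n ℂ) - 1‖ ≤ ε)
    (hsmall : 50 * (d + 1) * ε < (((L : ℝ) ^ d)⁻¹))
    (hW1 : ∀ r : Fin d → Fin L, ‖((Wcx L V₀ (corner L y) κ (boxVec L r) : (Matrix n n ℂ)ˣ) : Matrix n n ℂ) - 1‖ < 1)
    (hWρ : ∀ r : Fin d → Fin L,
      ‖((Wcx L V₀ (corner L y) κ (boxVec L r) : (Matrix n n ℂ)ˣ) : Matrix n n ℂ) - 1‖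
        < min (1 / 3) (3 / (Fintype.card n : ℝ))) :
    0 < LinearMap.det (fullCoeffOn L (specialUnitaryLogChart n).lie V₀ y κ hW1
        (fullCoeff_mem_lie (H := specialUnitaryUnits n) (specialUnitaryLogChart n) (fun _ => mem_specialUnitaryUnits)
          hV₀ y κ hW1 hWρ)) := by
  letI : CStarAlgebra (Matrix n n ℂ) := {}
  refine (det_fullCoeffOn_pos_iff (H := specialUnitaryUnits n) hL _ specialUnitaryUnits_le_U1
    ((specialUnitaryLogChart n).conjR_mem_lie fun _ => mem_specialUnitaryUnits) hV₀ y κ hε0 hε hW hsmall hW1 _).2 ?_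
  rw [det_conjROn_specialUnitary_eq_one (hol_mem_of hV₀ _ _)]
  exact one_pos

end SpecialUnitary

end Literature.MathematicalPhysics.QuantumFieldTheory.Balaban1983to89.B10Eq61DetPositive

end
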